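import Summits.ResolutionOfSingularities.ResolutionOfSingularities.Theorems.HomologicalConductorNoZenoExcCurveLift
import Literature.AlgebraicGeometry.Resolution.ExceptionalCurvesLocalizedResolution
import Literature.AlgebraicGeometry.Resolution.ExceptionalCurvePoints
import HarnessLib

/-!
# Crux `NoZenoR` (stmt-ResolutionOfSingularities-19943) — TERMINATION of Lipman's process of Theorem (4.1):
# the stages under a fixed desingularization carry at most `#excCurvePoints` exceptional curves, and a step with a
# positive-dimensional fibre strictly raises the count

Route `ResolutionOfSingularities/HomologicalConductor` (cell decomp-res, hand leafhand-res-homologicalconduct-21 g0).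
OURS: AI-written proof over tree theorems, weaker than expert review; nothing here is a statement of the manuscript
under review (Hironaka 2017).  SUPPORT level, counted 0.  Def-free, FACT-FREE.

Lipman, proof of Theorem (4.1) (p. 204): "these surfaces have only finitely many singular points … (For any such
point dominates one of the singular points `y` on `Y`, and so we need only see that any normal surface `W` which is
proper and birational over `Spec(𝒪_y)` has only finitely many singular points.  But such a surface `W` is dominated by
a regular surface `Z` …) As in Theorem (2.1), the preceding process leads eventually to a regular surface."  The
termination used by the tree's route (hand 16 g4's census: «termination by exceptional-curve counting») is the
elementary count below, for a FIXED desingularization `π : X → Spec S` of a two-dimensional Noetherian local domain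
and STAGES `g : W → Spec S` dominated by `X` (`σ : X → W` a resolution with `σ ≫ g = π`):

* `height_apply_le_of_isClosedMap` — heights (in the specialisation order) do not increase under a closed continuous
  map of schemes; `height_le_one_of_stage` — points of a stage over the closed point have height `≤ 1`;
* `exists_mem_excCurvePoints_apply_eq_of_stage` — **every integral exceptional curve of a stage `W` lifts** along a
  proper dominant `b : W₂ → W` from a stage `W₂` (generalising `ExcCount.exists_mem_excCurvePoints_apply_eq`, which
  needs `W` regular);
* **`finite_and_ncard_excCurvePoints_stage_le`** — `excCurvePoints g` is finite and
  `#excCurvePoints g ≤ #excCurvePoints π`;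
* **`ncard_excCurvePoints_lt_of_step`** — if `b : W₂ → W` is a proper dominant `S`-morphism of stages whose fibre over
  some point `w` of height `0` (e.g. a closed point) contains a NON-closed point, then
  `#excCurvePoints g < #excCurvePoints (b ≫ g)`.

Hence any chain of such steps below `X` has length `≤ #excCurvePoints π`.  What is NOT here: that the blowing up of
a stage at a non-regular normal point `w` HAS a positive-dimensional fibre over `w` (Zariski's Main Theorem at the
normal point `w` + `𝔪_w` not principal), and Prop. (8.1).  No crux, kill test or summit statement is proved here;
resolution in positive characteristic is NOT proved.

References: J. Lipman, Publ. Math. IHÉS 36 (1969), Theorem (4.1), proof (p. 204); Corollary (27.3), proof (p. 277)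
[`Lipman1969`].
-/

noncomputable section

-- single-problem summit: the doubled namespace component `ResolutionOfSingularities` is forced
set_option linter.dupNamespace false

open CategoryTheory CategoryTheory.Limits AlgebraicGeometry TopologicalSpace Topology IsLocalRing
open Literature.AlgebraicGeometry.Resolution

namespace Summit.ResolutionOfSingularities.ResolutionOfSingularities.Theorems.NoZeno.QuadraticTransform

/-! ## Heights under closed maps -/

section Height

variable {X Y : Scheme.{0}} (f : X ⟶ Y)

/-- In the specialisation order of a scheme, a proper specialisation is strictly smaller. [folklore] -/
private theorem lt_of_specializes_of_ne {Z : Scheme.{0}} {x y : Z} (h : y ⤳ x) (hne : x ≠ y) : x < y :=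
  ⟨Scheme.le_iff_specializes.2 h, fun h' => hne ((Scheme.le_iff_specializes.1 h').antisymm h).eq⟩

/-- Under a closed continuous map, a point strictly below `f x` is the image of a point strictly below `x`
(`cl{f x} = f(cl{x})`). [folklore] -/
theorem exists_lt_apply_eq_of_lt (hf : IsClosedMap f.base) {x : X} {b : Y} (hb : b < f x) :
    ∃ x₁ : X, x₁ < x ∧ f x₁ = b := by
  have hspec : f x ⤳ b := Scheme.le_iff_specializes.1 hb.le
  have hne : b ≠ f x := fun h => (h ▸ hb).ne rfl
  have hmem : b ∈ closure (f.base '' {x}) := by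
    rw [Set.image_singleton]
    exact specializes_iff_mem_closure.mp hspec
  obtain ⟨x₁, hx₁, hx₁b⟩ := hf.closure_image_subset {x} hmem
  refine ⟨x₁, lt_of_specializes_of_ne (specializes_iff_mem_closure.mpr hx₁) ?_, hx₁b⟩
  rintro rfl
  exact hne hx₁b.symm

/-- **Heights do not increase under a closed continuous map of schemes.** [folklore] -/
theorem height_apply_le_of_isClosedMap (hf : IsClosedMap f.base) :
    ∀ (n : ℕ) (x : X), Order.height x ≤ n → Order.height (f x) ≤ n := by
  intro n
  induction n with
  | zero =>
    intro x hx
    rw [Order.height_le_coe_iff] at hx ⊢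
    intro b hb
    obtain ⟨x₁, hx₁, -⟩ := exists_lt_apply_eq_of_lt f hf hb
    exact absurd (hx x₁ hx₁) (by simp)
  | succ n ih =>
    intro x hx
    rw [Order.height_le_coe_iff]
    intro b hb
    obtain ⟨x₁, hx₁, rfl⟩ := exists_lt_apply_eq_of_lt f hf hb
    have h1 : Order.height x₁ < ((n + 1 : ℕ) : ℕ∞) := Order.height_le_coe_iff.mp hx x₁ hx₁
    have h2 : Order.height x₁ ≤ n := by
      rw [Nat.cast_add, Nat.cast_one] at h1
      exact (ENat.lt_add_one_iff (ENat.coe_ne_top n)).mp h1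
    have h3 := ih x₁ h2
    calc Order.height (f x₁) ≤ n := h3
      _ < ((n + 1 : ℕ) : ℕ∞) := by exact_mod_cast Nat.lt_succ_self n

/-- A non-closed point of a quasi-compact scheme has positive height. [folklore] -/
theorem one_le_height_of_not_isClosed [CompactSpace X] {x : X} (hx : ¬ IsClosed ({x} : Set X)) :
    1 ≤ Order.height x := by
  obtain ⟨c, hc, hccl⟩ := (isClosed_closure (s := ({x} : Set X))).exists_closed_singleton ⟨x, subset_closure rfl⟩
  have hne : c ≠ x := by
    rintro rfl
    exact hx hccl
  have hlt : c < x := lt_of_specializes_of_ne (specializes_iff_mem_closure.mpr hc) hne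
  exact le_trans (by simp) (Order.height_add_one_le hlt)

end Height

/-! ## Stages under a fixed desingularization -/

section Stage

variable {S : Type} [CommRing S] [IsNoetherianRing S] [IsLocalRing S] [IsDomain S]
  {X W : Scheme.{0}} (π : X ⟶ Spec (.of S)) (g : W ⟶ Spec (.of S)) (σ : X ⟶ W)

/-- **Points of a stage over the closed point have height `≤ 1`**: they are images of closed-fibre points of the
dominating desingularization, whose heights are `≤ 1`. [cite: Lipman1969, Section 12 (p. 220)] -/
theorem height_le_one_of_stage (h2 : ringKrullDim S = 2) (hπ : IsResolution π) (hσ : IsResolution σ)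
    (hfac : σ ≫ g = π) {y : W} (hy : g y = closedPoint S) : Order.height y ≤ 1 := by
  haveI : IsProper σ := hσ.isProper
  haveI : IsDominant σ := hσ.isBirational.isDominant
  obtain ⟨x, rfl⟩ := ExcCount.surjective_of_isProper_of_isDominant σ y
  have hx : π x = closedPoint S := by rw [← hfac]; exact hy
  exact_mod_cast height_apply_le_of_isClosedMap σ σ.isClosedMap 1 x (by exact_mod_cast hπ.height_le_one_of_base_eq_closedPoint h2 hx)

omit [IsNoetherianRing S] [IsDomain S] in
/-- **Integral exceptional curves lift along a proper dominant morphism of stages.**  For `b : W₂ → W` proper and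
dominant with `W₂` a stage (its closed-fibre points have height `≤ 1`), every `η ∈ excCurvePoints g` is `b η₂` for some
`η₂ ∈ excCurvePoints (b ≫ g)`. [cite: Lipman1969, Corollary (27.3), proof (p. 277)] -/
theorem exists_mem_excCurvePoints_apply_eq_of_stage {W₂ : Scheme.{0}} (b : W₂ ⟶ W) [IsProper b] [IsDominant b]
    (hW₂ : ∀ y : W₂, (b ≫ g) y = closedPoint S → Order.height y ≤ 1)
    {η : W} (hη : η ∈ excCurvePoints g) : ∃ η₂ ∈ excCurvePoints (b ≫ g), b η₂ = η := by
  obtain ⟨y, hy⟩ := ExcCount.surjective_of_isProper_of_isDominant b η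
  have hy0 : (b ≫ g) y = closedPoint S := by
    change g (b y) = closedPoint S
    rw [hy]
    exact hη.1
  refine ⟨y, ⟨hy0, le_antisymm (hW₂ y hy0) ?_⟩, hy⟩
  -- height `≥ 1`: a proper specialisation of `η` lifts to one of `y`
  have hpos : ¬ IsMin η := by
    rw [← Order.height_ne_zero, hη.2]
    exact one_ne_zero
  obtain ⟨c, hc⟩ := not_isMin_iff.mp hpos
  obtain ⟨y₁, hy₁, -⟩ := exists_lt_apply_eq_of_lt b b.isClosedMap (x := y) (b := c) (by rw [hy]; exact hc)
  exact le_trans (by simp) (Order.height_add_one_le hy₁)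

/-- **A stage has finitely many integral exceptional curves, at most as many as the dominating desingularization**:
`excCurvePoints g` is finite and `#excCurvePoints g ≤ #excCurvePoints π`. [cite: Lipman1969, Theorem (4.1), proof (p. 204)] -/
theorem finite_and_ncard_excCurvePoints_stage_le (h2 : ringKrullDim S = 2) (hπ : IsResolution π)
    (hσ : IsResolution σ) (hfac : σ ≫ g = π) :
    (excCurvePoints g).Finite ∧ (excCurvePoints g).ncard ≤ (excCurvePoints π).ncard := by
  classical
  haveI : IsProper σ := hσ.isProper
  haveI : IsDominant σ := hσ.isBirational.isDominant
  haveI : IsIntegral X := hπ.isIntegral_source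
  have hX : ∀ y : X, (σ ≫ g) y = closedPoint S → Order.height y ≤ 1 := fun y hy =>
    hπ.height_le_one_of_base_eq_closedPoint h2 (by rw [← hfac]; exact hy)
  have hlift : ∀ η ∈ excCurvePoints g, ∃ x ∈ excCurvePoints π, σ x = η := fun η hη => by
    obtain ⟨x, hx, hxη⟩ := exists_mem_excCurvePoints_apply_eq_of_stage g σ hX hη
    exact ⟨x, by rw [← hfac]; exact hx, hxη⟩
  choose! L hL hLσ using hlift
  have hfin : (excCurvePoints π).Finite := hπ.excCurvePoints_finite h2
  have hmaps : Set.MapsTo L (excCurvePoints g) (excCurvePoints π) := fun η hη => hL η hη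
  have hinj : Set.InjOn L (excCurvePoints g) := fun η hη η' hη' h => by
    rw [← hLσ η hη, ← hLσ η' hη', h]
  exact ⟨Set.Finite.of_injOn hmaps hinj hfin, Set.ncard_le_ncard_of_injOn L hmaps hinj hfin⟩

/-- **A step with a positive-dimensional fibre strictly raises the count.**  Let `b : W₂ → W` be a proper dominant
`S`-morphism of stages (`σ₂ : X → W₂` a resolution, `σ₂ ≫ b ≫ g = π`).  If the fibre of `b` over a point `w` of
height `0` (a closed point) contains a point `ζ` which is NOT closed, then `#excCurvePoints g < #excCurvePoints (b ≫ g)`: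
the lifts of the curves of `W` are curves of `W₂` other than `cl{ζ}`. [cite: Lipman1969, Theorem (4.1), proof (p. 204)] -/
theorem ncard_excCurvePoints_lt_of_step (h2 : ringKrullDim S = 2) (hπ : IsResolution π)
    {W₂ : Scheme.{0}} (b : W₂ ⟶ W) [IsProper b] [IsDominant b] (σ₂ : X ⟶ W₂) (hσ₂ : IsResolution σ₂)
    (hfac : σ₂ ≫ b ≫ g = π) {w : W} (hw : Order.height w = 0) (hgw : g w = closedPoint S)
    {ζ : W₂} (hζw : b ζ = w) (hζ : ¬ IsClosed ({ζ} : Set W₂)) :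
    (excCurvePoints g).ncard < (excCurvePoints (b ≫ g)).ncard := by
  classical
  haveI : IsProper σ₂ := hσ₂.isProper
  haveI : IsProper π := hπ.isProper
  haveI : Nonempty W₂ := ⟨ζ⟩
  haveI : CompactSpace W₂ := by
    haveI : IsDominant σ₂ := hσ₂.isBirational.isDominant
    haveI : CompactSpace X := QuasiCompact.compactSpace_of_compactSpace π
    exact ⟨by
      rw [← (ExcCount.surjective_of_isProper_of_isDominant σ₂).range_eq]
      exact isCompact_range σ₂.continuous⟩
  have hW₂ : ∀ y : W₂, (b ≫ g) y = closedPoint S → Order.height y ≤ 1 := fun y hy =>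
    height_le_one_of_stage π (b ≫ g) σ₂ h2 hπ hσ₂ hfac hy
  obtain ⟨hfin₂, -⟩ := finite_and_ncard_excCurvePoints_stage_le π (b ≫ g) σ₂ h2 hπ hσ₂ hfac
  -- lifts of the curves of `W`
  have hlift : ∀ η ∈ excCurvePoints g, ∃ η₂ ∈ excCurvePoints (b ≫ g), b η₂ = η := fun η hη =>
    exists_mem_excCurvePoints_apply_eq_of_stage g b hW₂ hη
  choose! L hL hLb using hlift
  have hinj : Set.InjOn L (excCurvePoints g) := fun η hη η' hη' h => by
    rw [← hLb η hη, ← hLb η' hη', h]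
  -- the new curve `ζ`
  have hζmem : ζ ∈ excCurvePoints (b ≫ g) := by
    have h0 : (b ≫ g) ζ = closedPoint S := by
      change g (b ζ) = closedPoint S
      rw [hζw]
      exact hgw
    exact ⟨h0, le_antisymm (hW₂ ζ h0) (one_le_height_of_not_isClosed hζ)⟩
  have hζnot : ζ ∉ L '' excCurvePoints g := by
    rintro ⟨η, hη, hηζ⟩
    have h1 : b ζ = η := by rw [← hηζ]; exact hLb η hη
    rw [hζw] at h1
    have := hη.2
    rw [← h1, hw] at this
    exact zero_ne_one this
  -- count
  have hsub : insert ζ (L '' excCurvePoints g) ⊆ excCurvePoints (b ≫ g) := by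
    refine Set.insert_subset hζmem ?_
    rintro _ ⟨η, hη, rfl⟩
    exact hL η hη
  calc (excCurvePoints g).ncard = (L '' excCurvePoints g).ncard := (hinj.ncard_image).symm
    _ < (insert ζ (L '' excCurvePoints g)).ncard := by
        rw [Set.ncard_insert_of_notMem hζnot (hfin₂.subset (hsub.trans' (Set.subset_insert _ _)))]
        exact Nat.lt_succ_self _
    _ ≤ (excCurvePoints (b ≫ g)).ncard := Set.ncard_le_ncard hsub hfin₂

end Stage

end Summit.ResolutionOfSingularities.ResolutionOfSingularities.Theorems.NoZeno.QuadraticTransform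

end
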